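import Literature.IUT.HodgeTheaters.GlobalFrobenioids
import Literature.IUT.HodgeTheaters.GlobalFrobenioidsKummer
import Literature.IUT.HodgeTheaters.GlobalFrobenioidsCyclotomes
import Literature.IUT.HodgeTheaters.GlobalFrobenioidsInfKappa
import HarnessLib

/-!
# [IUTchI] Example 5.1 (v): the MODEL coric pairs `π₁^rat(†𝒟^⊛) ↷ 𝕄^⊛_∞κ(†𝒟^⊚)`, `𝕄^⊛_∞κ×(†𝒟^⊚)` and
# the printed "factors / does not factor through `π₁^{κ-sol}`" and Kummer-injectivity clauses

Mochizuki, *Inter-universal Teichmüller theory I*, §5, Example 5.1 "Global Frobenioids", part (v),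
kurims manuscript (May 2020) pp. 127–128 ([IUTchI] Ex 5.1 (v) pp.127–128)
[claim: Mochizuki2012, status: disputed].  Sub-DAG statements file for the SUBDAG-WANTED row
«IUTchI:Ex5.1(i)–(vii)» (HOME plan/L5, director-frontier 2026-08-25T23:59:05Z queue (1);
nodes = IUTchI:Ex5.1(v)); STATEMENTS-FIRST with the provable steps PROVED; nothing of the disputed
content is asserted; no new Literature fact.

**What was missing.**  The sibling files type the (v) vocabulary — `CoricPair`, `CoricPair.Iso`,
`IsCoricStructure Γ model P`, `ExistsUniqueCoricStructure Γ model`, `DeterminesInfκStructure … modelInfκ`,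
`ModSolReconstruction.RecoversModel N A model` (abc-iut-L5-t1 `GlobalFrobenioidsKummer.lean`,
abc-iut-L5-t12 `GlobalFrobenioidsCyclotomes.lean` / `GlobalFrobenioidsInfKappa.lean`) — always over an
ABSTRACT parameter `model : CoricPair Γ`.  The printed model "the pair `π₁^rat(†𝒟^⊛) ↷ 𝕄^⊛_∞κ(†𝒟^⊚)`
(respectively, `π₁^rat(†𝒟^⊛) ↷ 𝕄^⊛_∞κ×(†𝒟^⊚)`) of (i)" (p. 127) is CONSTRUCTED here from the (i)-data
`N : NFBridgeRecon` (abc-iut-L5-t1 `GlobalFrobenioids.lean`): `NFBridgeRecon.infκPair`,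
`NFBridgeRecon.infκxPair` (via the general `coricPairOfSubset`: a `π₁^rat`-stable set of rational
functions with the field multiplication restricted to it, [IUTchI] §0 pseudo-monoids).  With the model
real, two printed clauses become kernel statements about the literal `IsCoricStructure`:

* p. 127: "Thus, the `π₁^rat(†𝒟^⊛)`-action that appears in an ∞κ-coric (respectively, ∞κ×-coric)
  structure necessarily factors (respectively, does not factor) through the natural surjection
  `π₁^rat(†𝒟^⊛) ↠ π₁^{κ-sol}(†𝒟^⊛)` of (i)" — `IsCoricStructure.factorsThrough_ratKsolKer` (PROVED: by the
  DEFINITION of `π₁^{rat/κ-sol}` as a subgroup of the kernel of the action on `𝕄^⊛_∞κ`, p. 124, and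
  transport along the structure isomorphism); the ∞κ× clause `IsCoricStructure.not_factorsThrough`
  (PROVED from its printed input, kept as an EXPLICIT HYPOTHESIS: some element of `π₁^{rat/κ-sol}` moves
  some ∞κ×-coric function — Rmk 3.1.7 (ii)/(iii): the ∞κ×-coric functions contain the constants `F̄^×`).
* p. 127: "consideration of Kummer classes … yields a natural injection of `†𝕄^⊛_∞κ` (respectively,
  `†𝕄^⊛_∞κ×`) into `lim_H H¹(H, μ_Ẑ(·))` … the asserted injectivity follows immediately from the
  corresponding injectivity in the case of `𝕄^⊛_∞κ(†𝒟^⊚)`" — `CoricPair.KummerRealization.ofIso`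
  (transport of abc-iut-L5-t12's `KummerRealization` along an isomorphism of pairs; PROVED) and
  `IsCoricStructure.nonempty_kummerRealization`.
* p. 128: "unique up to a uniquely determined isomorphism" — `existsUniqueCoricStructure_of_kummerRigid`:
  the typed `ExistsUniqueCoricStructure` for the MODEL follows from "every automorphism of the model
  pair is compatible with its Kummer map" (the content of the unique-cyclotome-isomorphism display,
  `UniqueCyclotomeIso`; PROVED as a reduction, the rigidity kept as an explicit hypothesis).

Small API added for the sibling vocabulary (no twin in the tree, grep 2026-08-26): `CoricPair.Iso.symm`,
`CoricPair.Iso.trans`, `IsCoricStructure.of_iso`.  No printed statement is strengthened; no side taken.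
-/

namespace Literature.IUT.HodgeTheaters

open Pointwise

universe u

/-! ### API: inverse and composite of isomorphisms of pairs -/

section IsoAPI

variable {Γ : Type u} [Group Γ] [TopologicalSpace Γ]

namespace CoricPair

/-- The inverse of an isomorphism of pairs. ([IUTchI] Ex 5.1 (v) p.127) [claim: Mochizuki2012, status: disputed] -/
def Iso.symm {P Q : CoricPair Γ} (e : Iso P Q) : Iso Q P where
  toEquiv := e.toEquiv.symm
  smul g y := e.toEquiv.injective (by
    rw [Equiv.apply_symm_apply, e.smul, Equiv.apply_symm_apply])
  dom q := by
    have h := e.dom (e.toEquiv.symm q.1, e.toEquiv.symm q.2)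
    simp only [Equiv.apply_symm_apply] at h
    exact h.symm
  op q := e.toEquiv.injective (by
    rw [Equiv.apply_symm_apply, e.op]
    congr 1
    exact Subtype.ext (by simp))

/-- `e.symm (e x) = x`. ([IUTchI] Ex 5.1 (v) p.127) [claim: Mochizuki2012, status: disputed] -/
@[simp] theorem Iso.symm_apply_apply {P Q : CoricPair Γ} (e : Iso P Q) (x : P.carrier) :
    e.symm.toEquiv (e.toEquiv x) = x :=
  e.toEquiv.symm_apply_apply x

/-- `e (e.symm y) = y`. ([IUTchI] Ex 5.1 (v) p.127) [claim: Mochizuki2012, status: disputed] -/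
@[simp] theorem Iso.apply_symm_apply {P Q : CoricPair Γ} (e : Iso P Q) (y : Q.carrier) :
    e.toEquiv (e.symm.toEquiv y) = y :=
  e.toEquiv.apply_symm_apply y

/-- The composite of isomorphisms of pairs. ([IUTchI] Ex 5.1 (v) p.127) [claim: Mochizuki2012, status: disputed] -/
def Iso.trans {P Q R : CoricPair Γ} (e : Iso P Q) (f : Iso Q R) : Iso P R where
  toEquiv := e.toEquiv.trans f.toEquiv
  smul g x := by
    change f.toEquiv (e.toEquiv (g • x)) = g • f.toEquiv (e.toEquiv x)
    rw [e.smul, f.smul]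
  dom p := (e.dom p).trans (f.dom (e.toEquiv p.1, e.toEquiv p.2))
  op p := by
    change f.toEquiv (e.toEquiv (P.pm.op p)) = _
    rw [e.op, f.op]
    rfl

end CoricPair

/-- Being a coric structure is transported along isomorphisms of pairs. ([IUTchI] Ex 5.1 (v) p.127)
[claim: Mochizuki2012, status: disputed] -/
theorem IsCoricStructure.of_iso {model P Q : CoricPair Γ} (h : IsCoricStructure Γ model P)
    (e : CoricPair.Iso Q P) : IsCoricStructure Γ model Q :=
  ⟨⟨e.trans h.nonempty_iso.some⟩⟩

/-- The model is a coric structure on itself, and so is anything isomorphic to a coric structure —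
symmetric form. ([IUTchI] Ex 5.1 (v) p.127) [claim: Mochizuki2012, status: disputed] -/
theorem IsCoricStructure.symm {model P : CoricPair Γ} (h : IsCoricStructure Γ model P) :
    IsCoricStructure Γ P model :=
  ⟨⟨h.nonempty_iso.some.symm⟩⟩

end IsoAPI

/-! ### The model pairs of (v), built from the data of (i) (p. 127) -/

namespace NFBridgeRecon

variable (N : NFBridgeRecon.{u})

/-- A `π₁^rat(†𝒟^⊛)`-stable set `S` of rational functions as a pair "consisting of a pseudo-monoid
equipped with a continuous action by `π₁^rat(†𝒟^⊛)`" (p. 127): carrier `S`, partial multiplication =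
the multiplication of the field of rational functions restricted to the pairs whose product stays in
`S` ([IUTchI] §0 p. 33), action = the restricted `π₁^rat`-action (open stabilisers from the data of
(i)). ([IUTchI] Ex 5.1 (v) p.127) [claim: Mochizuki2012, status: disputed] -/
abbrev coricPairOfSubset (S : Set N.Krat) (hS : ∀ (g : N.piRat) {f : N.Krat}, f ∈ S → g • f ∈ S) :
    CoricPair N.piRat where
  carrier := (⟨S, fun g _ hf => hS g hf⟩ : SubMulAction N.piRat N.Krat)
  pm :=
    { dom := {p | (p.1 : N.Krat) * p.2 ∈ S}
      op := fun p => ⟨(p.1.1 : N.Krat) * p.1.2, p.2⟩ }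
  isOpen_stabilizer x := by
    rw [SubMulAction.stabilizer_of_subMul]
    exact N.isOpen_stabilizer_krat _
  smul_dom g p := by
    change (p.1 : N.Krat) * p.2 ∈ S ↔ (g • (p.1 : N.Krat)) * (g • (p.2 : N.Krat)) ∈ S
    rw [← smul_mul']
    exact ⟨fun h => hS g h, fun h => by simpa using hS g⁻¹ h⟩
  smul_op g p := Subtype.ext (smul_mul' g (p.1.1 : N.Krat) p.1.2)

/-- The carrier of `coricPairOfSubset S` is `S`. ([IUTchI] Ex 5.1 (v) p.127) [claim: Mochizuki2012, status: disputed] -/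
@[simp] theorem coe_smul_coricPairOfSubset (S : Set N.Krat)
    (hS : ∀ (g : N.piRat) {f : N.Krat}, f ∈ S → g • f ∈ S) (g : N.piRat)
    (x : (N.coricPairOfSubset S hS).carrier) :
    ((g • x : (N.coricPairOfSubset S hS).carrier) : N.Krat) = g • (x : N.Krat) := rfl

/-- Such a pair IS a pseudo-monoid in the sense of [IUTchI] §0 (realised in the multiplicative group
of the field of rational functions by the inclusion), provided `0 ∉ S`.
([IUTchI] Ex 5.1 (v) p.127) [claim: Mochizuki2012, status: disputed] -/
theorem isPseudoMonoid_coricPairOfSubset (S : Set N.Krat)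
    (hS : ∀ (g : N.piRat) {f : N.Krat}, f ∈ S → g • f ∈ S) (h0 : (0 : N.Krat) ∉ S) :
    (N.coricPairOfSubset S hS).pm.IsPseudoMonoid := by
  classical
  have hne : ∀ x : (N.coricPairOfSubset S hS).carrier, (x : N.Krat) ≠ 0 := by
    intro x hx
    exact h0 (hx ▸ x.2)
  refine ⟨(N.Krat)ˣ, inferInstance, fun x => Units.mk0 (x : N.Krat) (hne x), ⟨?_, ?_, ?_⟩⟩
  · intro x y hxy
    apply Subtype.ext
    simpa [Units.mk0] using congrArg (fun u : (N.Krat)ˣ => (u : N.Krat)) hxy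
  · ext p
    change (p.1 : N.Krat) * p.2 ∈ S ↔ _
    constructor
    · intro hp
      refine ⟨⟨(p.1 : N.Krat) * p.2, hp⟩, Units.ext ?_⟩
      simp
    · rintro ⟨z, hz⟩
      have hz' := congrArg (fun u : (N.Krat)ˣ => (u : N.Krat)) hz
      simp only [Units.val_mk0, Units.val_mul] at hz'
      rw [← hz']
      exact z.2
  · intro p
    exact Units.ext (by simp)

/-- **The model ∞κ-pair** `π₁^rat(†𝒟^⊛) ↷ 𝕄^⊛_∞κ(†𝒟^⊚)` of (i)/(v) (p. 127, "the pair … of (i)").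
([IUTchI] Ex 5.1 (v) p.127) [claim: Mochizuki2012, status: disputed] -/
abbrev infκPair : CoricPair N.piRat := N.coricPairOfSubset N.Minfκ (fun g _ hf => N.smul_mem_minfκ g hf)

/-- **The model ∞κ×-pair** `π₁^rat(†𝒟^⊛) ↷ 𝕄^⊛_∞κ×(†𝒟^⊚)` of (i)/(v) (p. 127).
([IUTchI] Ex 5.1 (v) p.127) [claim: Mochizuki2012, status: disputed] -/
abbrev infκxPair : CoricPair N.piRat := N.coricPairOfSubset N.Minfκx (fun g _ hf => N.smul_mem_minfκx g hf)

/-- The model ∞κ-pair is a pseudo-monoid ([IUTchI] §0): `0` is not an ∞κ-coric function.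
([IUTchI] Ex 5.1 (v) p.127) [claim: Mochizuki2012, status: disputed] -/
theorem infκPair_isPseudoMonoid : N.infκPair.pm.IsPseudoMonoid :=
  N.isPseudoMonoid_coricPairOfSubset _ _ fun h => N.zero_notMem (N.minfκ_subset h)

/-- The model ∞κ×-pair is a pseudo-monoid ([IUTchI] §0).
([IUTchI] Ex 5.1 (v) p.127) [claim: Mochizuki2012, status: disputed] -/
theorem infκxPair_isPseudoMonoid : N.infκxPair.pm.IsPseudoMonoid :=
  N.isPseudoMonoid_coricPairOfSubset _ _ N.zero_notMem

/-- `𝕄^⊛_∞κ ⊆ 𝕄^⊛_∞κ×` as a morphism of model pairs: the inclusion is `π₁^rat`-equivariant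
(p. 128: "`†𝕄^⊛_∞κ ↪ †𝕄^⊛_∞κ×`"). ([IUTchI] Ex 5.1 (v) p.128) [claim: Mochizuki2012, status: disputed] -/
theorem infκPair_incl_smul (g : N.piRat) (x : N.infκPair.carrier) :
    ((⟨(↑(g • x) : N.Krat), N.minfκ_subset (g • x).2⟩ : N.infκxPair.carrier) : N.Krat) =
      ((g • (⟨(x : N.Krat), N.minfκ_subset x.2⟩ : N.infκxPair.carrier) : N.infκxPair.carrier) : N.Krat) :=
  rfl

/-! ### "factors (respectively, does not factor) through `π₁^rat ↠ π₁^{κ-sol}`" (p. 127) -/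

/-- The model ∞κ-pair's action factors through `π₁^rat(†𝒟^⊛) ↠ π₁^{κ-sol}(†𝒟^⊛)`: by DEFINITION (p. 124)
`π₁^{rat/κ-sol}` lies in the kernel of the action on `𝕄^⊛_∞κ(†𝒟^⊚)`.  PROVED.
([IUTchI] Ex 5.1 (v) p.127) [claim: Mochizuki2012, status: disputed] -/
theorem infκPair_factorsThrough : N.infκPair.FactorsThrough N.ratKsolKer := by
  intro g hg x
  apply Subtype.ext
  exact (Subgroup.mem_inf.mp hg).1 (x : N.Krat) x.2

/-- **Ex. 5.1 (v), p. 127** — "Thus, the `π₁^rat(†𝒟^⊛)`-action that appears in an ∞κ-coric … structure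
necessarily factors … through the natural surjection `π₁^rat(†𝒟^⊛) ↠ π₁^{κ-sol}(†𝒟^⊛)` of (i)": for every
∞κ-coric structure `P` on `†ℱ^⊛` [a pair isomorphic to the model ∞κ-pair], `π₁^{rat/κ-sol}` acts trivially
on `P`.  PROVED. ([IUTchI] Ex 5.1 (v) p.127) [claim: Mochizuki2012, status: disputed] -/
theorem IsCoricStructure.factorsThrough_ratKsolKer {P : CoricPair N.piRat}
    (h : IsCoricStructure N.piRat N.infκPair P) : P.FactorsThrough N.ratKsolKer :=
  CoricPair.FactorsThrough.of_iso h.nonempty_iso.some N.infκPair_factorsThrough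

/-- **Ex. 5.1 (v), p. 127** — "(respectively, does not factor)": for every ∞κ×-coric structure `P` on
`†ℱ^⊛`, `π₁^{rat/κ-sol}(†𝒟^⊛)` does NOT act trivially on `P` — PROVED from the printed input, kept as
the explicit hypothesis `hmoves`: some element of `π₁^{rat/κ-sol}(†𝒟^⊛)` moves some ∞κ×-coric rational
function of the model [Rmk 3.1.7 (ii), (iii): the ∞κ×-coric functions contain the constants `F̄^×`
(`NFBridgeRecon.ConstantsInfκx`), on which `π₁^{rat/κ-sol}` acts through a subgroup of `G_{F_mod}`
meeting `Gal(F̄/F^{sol})` non-trivially].  The hypothesis is a sub-DAG row (status ∅), not a fact.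
([IUTchI] Ex 5.1 (v) p.127) [claim: Mochizuki2012, status: disputed] -/
theorem IsCoricStructure.not_factorsThrough_ratKsolKer {P : CoricPair N.piRat}
    (h : IsCoricStructure N.piRat N.infκxPair P)
    (hmoves : ∃ g ∈ N.ratKsolKer, ∃ f ∈ N.Minfκx, g • f ≠ f) :
    ¬ P.FactorsThrough N.ratKsolKer := by
  intro hP
  obtain ⟨g, hg, f, hf, hne⟩ := hmoves
  have hmodel : N.infκxPair.FactorsThrough N.ratKsolKer :=
    CoricPair.FactorsThrough.of_iso h.nonempty_iso.some.symm hP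
  have := congrArg (fun y : N.infκxPair.carrier => (y : N.Krat)) (hmodel g hg ⟨f, hf⟩)
  exact hne this

/-- Conversely, if `π₁^{rat/κ-sol}` fixed every ∞κ×-coric function of the model then EVERY ∞κ×-coric
structure would factor through `π₁^{κ-sol}` — so the hypothesis `hmoves` above is exactly what the
printed "does not factor" clause needs (kernel-checked equivalence at the model).
([IUTchI] Ex 5.1 (v) p.127) [claim: Mochizuki2012, status: disputed] -/
theorem infκxPair_factorsThrough_iff :
    N.infκxPair.FactorsThrough N.ratKsolKer ↔ ∀ g ∈ N.ratKsolKer, ∀ f ∈ N.Minfκx, g • f = f := by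
  constructor
  · intro h g hg f hf
    exact congrArg (fun y : N.infκxPair.carrier => (y : N.Krat)) (h g hg ⟨f, hf⟩)
  · intro h g hg x
    exact Subtype.ext (h g hg (x : N.Krat) x.2)

end NFBridgeRecon

/-! ### Kummer injectivity transported along the structure isomorphism (p. 127) -/

section Kummer

variable {Γ : Type u} [Group Γ] [TopologicalSpace Γ]

namespace CoricPair.KummerRealization

variable {P Q : CoricPair Γ} {H : Type u} [CommGroup H] [MulAction Γ H]

/-- **Ex. 5.1 (v), p. 127** — "consideration of Kummer classes … yields a natural injection of `†𝕄^⊛_∞κ`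
(respectively, `†𝕄^⊛_∞κ×`) into `lim_H H¹(H, μ_Ẑ(†𝕄^⊛_∞κ))` …, and we observe that the asserted
injectivity follows immediately from the corresponding injectivity in the case of `𝕄^⊛_∞κ(†𝒟^⊚)`":
a Kummer realisation of `Q` [e.g. the model, abc-iut-L5-t12's `KummerRealization`: an injective,
equivariant map realising the pseudo-monoid structure] composed with an isomorphism of pairs
`e : P ⥲ Q` is a Kummer realisation of `P` [after the identification of cyclotome containers induced
by `e`, here the same abstract `H`].  PROVED (construction). ([IUTchI] Ex 5.1 (v) p.127)
[claim: Mochizuki2012, status: disputed] -/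
def ofIso (e : Iso P Q) (κQ : Q.KummerRealization H) : P.KummerRealization H where
  toFun x := κQ.toFun (e.toEquiv x)
  realizes :=
    { injective := κQ.realizes.injective.comp e.toEquiv.injective
      dom_eq := by
        ext p
        rw [e.dom p, κQ.realizes.dom_eq]
        simp only [Set.mem_setOf_eq]
        constructor
        · rintro ⟨y, hy⟩
          exact ⟨e.toEquiv.symm y, by simpa using hy⟩
        · rintro ⟨x, hx⟩
          exact ⟨e.toEquiv x, hx⟩
      op_eq := fun p => by
        rw [e.op, κQ.realizes.op_eq] }
  smul g x := by
    rw [e.smul, κQ.smul]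

/-- The transported realisation is compatible with the original one along `e` (p. 128 "induces").
([IUTchI] Ex 5.1 (v) p.128) [claim: Mochizuki2012, status: disputed] -/
theorem ofIso_isCompatible (e : Iso P Q) (κQ : Q.KummerRealization H) :
    e.IsCompatible (ofIso e κQ) κQ := fun _ => rfl

/-- The Kummer map of the transported realisation is injective (the printed "asserted injectivity").
([IUTchI] Ex 5.1 (v) p.127) [claim: Mochizuki2012, status: disputed] -/
theorem ofIso_injective (e : Iso P Q) (κQ : Q.KummerRealization H) :
    Function.Injective (ofIso e κQ).toFun :=
  (ofIso e κQ).realizes.injective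

end CoricPair.KummerRealization

/-- **Ex. 5.1 (v), p. 127**, structure form: every coric structure relative to a model that carries a
Kummer realisation in `H` carries an (injective, equivariant) Kummer realisation in `H`.  PROVED.
([IUTchI] Ex 5.1 (v) p.127) [claim: Mochizuki2012, status: disputed] -/
theorem IsCoricStructure.nonempty_kummerRealization {model P : CoricPair Γ} {H : Type u} [CommGroup H]
    [MulAction Γ H] (h : IsCoricStructure Γ model P) (κ : model.KummerRealization H) :
    Nonempty (P.KummerRealization H) :=
  ⟨CoricPair.KummerRealization.ofIso h.nonempty_iso.some κ⟩

/-! ### "unique up to a uniquely determined isomorphism" for the MODEL (p. 128) -/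

/-- **Ex. 5.1 (v), p. 128** — "`†ℱ^⊛` always admits an ∞κ-coric (respectively, ∞κ×-coric) structure,
which is, moreover, unique up to a uniquely determined isomorphism": the typed form
`ExistsUniqueCoricStructure Γ model` (existence + rigidity of the model pair) FOLLOWS from Kummer
rigidity of the model — every automorphism of the model pair is compatible with its Kummer map `κ`
[which is what the uniquely determined cyclotome isomorphism of p. 128 (`UniqueCyclotomeIso`;
`Aut(μ_Ẑ) = Ẑ^×` and "`ℚ_{>0} ∩ Ẑ^× = {1}`", tree `Rat.eq_one_of_forall_padicValRat_eq_zero`) supplies] —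
by abc-iut-L5-t12's `CoricPair.Iso.eq_of_isCompatible` (injectivity of `κ`).  PROVED as a reduction;
the rigidity is an explicit hypothesis (sub-DAG row, status ∅), not a fact.
([IUTchI] Ex 5.1 (v) p.128) [claim: Mochizuki2012, status: disputed] -/
theorem existsUniqueCoricStructure_of_kummerRigid {model : CoricPair Γ} {H : Type u} [CommGroup H]
    [MulAction Γ H] (κ : model.KummerRealization H)
    (hrigid : ∀ e : CoricPair.Iso model model, e.IsCompatible κ κ) :
    ExistsUniqueCoricStructure Γ model :=
  ⟨exists_coricStructure Γ model,
    ⟨fun e e' => CoricPair.Iso.eq_of_isCompatible (hrigid e) (hrigid e')⟩⟩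

/-- Under the same Kummer rigidity, ANY two coric structures `P`, `P'` relative to the model are related
by exactly one isomorphism of pairs compatible with their transported Kummer maps ("uniquely
determined isomorphism", p. 128, between two structures rather than with the model).  PROVED.
([IUTchI] Ex 5.1 (v) p.128) [claim: Mochizuki2012, status: disputed] -/
theorem IsCoricStructure.existsUnique_iso_of_kummer {model P P' : CoricPair Γ} {H : Type u}
    [CommGroup H] [MulAction Γ H] (κ : model.KummerRealization H)
    (h : IsCoricStructure Γ model P) (h' : IsCoricStructure Γ model P')
    (hrange : Set.range (CoricPair.KummerRealization.ofIso h.nonempty_iso.some κ).toFun =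
      Set.range (CoricPair.KummerRealization.ofIso h'.nonempty_iso.some κ).toFun) :
    ∃! e : CoricPair.Iso P P',
      e.IsCompatible (CoricPair.KummerRealization.ofIso h.nonempty_iso.some κ)
        (CoricPair.KummerRealization.ofIso h'.nonempty_iso.some κ) :=
  CoricPair.KummerRealization.existsUnique_iso _ _ hrange

/-- The images of the transported Kummer maps of two coric structures COINCIDE (both equal the image of
the model's Kummer map) — so the range hypothesis of `IsCoricStructure.existsUnique_iso_of_kummer` is
automatic.  PROVED. ([IUTchI] Ex 5.1 (v) p.128) [claim: Mochizuki2012, status: disputed] -/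
theorem IsCoricStructure.range_kummer_ofIso_eq {model P : CoricPair Γ} {H : Type u} [CommGroup H]
    [MulAction Γ H] (κ : model.KummerRealization H) (h : IsCoricStructure Γ model P) :
    Set.range (CoricPair.KummerRealization.ofIso h.nonempty_iso.some κ).toFun = Set.range κ.toFun := by
  ext y
  constructor
  · rintro ⟨x, rfl⟩
    exact ⟨_, rfl⟩
  · rintro ⟨z, rfl⟩
    refine ⟨h.nonempty_iso.some.symm.toEquiv z, ?_⟩
    change κ.toFun (h.nonempty_iso.some.toEquiv (h.nonempty_iso.some.symm.toEquiv z)) = κ.toFun z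
    rw [CoricPair.Iso.apply_symm_apply]

/-- Hence: any two coric structures relative to a Kummer-realised model are related by EXACTLY ONE
isomorphism of pairs compatible with the Kummer maps — the "uniquely determined isomorphism" of
p. 128, unconditionally in the typed vocabulary.  PROVED. ([IUTchI] Ex 5.1 (v) p.128)
[claim: Mochizuki2012, status: disputed] -/
theorem IsCoricStructure.existsUnique_iso {model P P' : CoricPair Γ} {H : Type u}
    [CommGroup H] [MulAction Γ H] (κ : model.KummerRealization H)
    (h : IsCoricStructure Γ model P) (h' : IsCoricStructure Γ model P') :
    ∃! e : CoricPair.Iso P P',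
      e.IsCompatible (CoricPair.KummerRealization.ofIso h.nonempty_iso.some κ)
        (CoricPair.KummerRealization.ofIso h'.nonempty_iso.some κ) :=
  h.existsUnique_iso_of_kummer κ h' ((h.range_kummer_ofIso_eq κ).trans (h'.range_kummer_ofIso_eq κ).symm)

end Kummer

/-! ### v2 (append-only): the invariant sub-pairs `†𝕄^⊛_κ ⊆ †𝕄^⊛_∞κ`, `†𝕄^⊛_{κ-sol} ⊆ †𝕄^⊛_∞κ×`
(Ex. 5.1 (v), p. 128 bottom – p. 129 top) -/

section Invariants

variable {Γ : Type u} [Group Γ] [TopologicalSpace Γ]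

namespace CoricPair

/-- The elements of a pair `Γ ↷ P` fixed by a NORMAL subgroup `N ⊴ Γ` form a `Γ`-stable subset
(`n·(g·x) = g·((g⁻¹ n g)·x)`).  [Used for "the respective sub-pseudo-monoids of `π₁^rat(†𝒟^⊛)`-,
`π₁^{rat/κ-sol}(†𝒟^⊛)`-invariants", p. 129.] ([IUTchI] Ex 5.1 (v) p.129) [claim: Mochizuki2012, status: disputed] -/
def fixedSub (P : CoricPair Γ) (N : Subgroup Γ) [hN : N.Normal] : SubMulAction Γ P.carrier where
  carrier := {x | ∀ n ∈ N, n • x = x}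
  smul_mem' g x hx := by
    intro n hn
    have h := hx (g⁻¹ * n * g) (hN.conj_mem' n hn g)
    calc n • g • x = (g * (g⁻¹ * n * g)) • x := by rw [smul_smul]; group
      _ = g • x := by rw [mul_smul, h]

/-- Membership in the fixed subset, unfolded. ([IUTchI] Ex 5.1 (v) p.129) [claim: Mochizuki2012, status: disputed] -/
theorem mem_fixedSub_iff (P : CoricPair Γ) (N : Subgroup Γ) [N.Normal] (x : P.carrier) :
    x ∈ P.fixedSub N ↔ ∀ n ∈ N, n • x = x :=
  Iff.rfl

/-- **The sub-pair of `N`-invariants** of a pair `Γ ↷ P` (`N ⊴ Γ`): "`†𝕄^⊛_κ ⊆ †𝕄^⊛_∞κ`,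
`†𝕄^⊛_{κ-sol} ⊆ †𝕄^⊛_∞κ×` for the respective sub-pseudo-monoids of `π₁^rat(†𝒟^⊛)`-,
`π₁^{rat/κ-sol}(†𝒟^⊛)`-invariants" (p. 128 l. 79 – p. 129 l. 4) — REAL, via abc-iut-L5-t12's
`CoricPair.restrict`. ([IUTchI] Ex 5.1 (v) p.129) [claim: Mochizuki2012, status: disputed] -/
def invariants (P : CoricPair Γ) (N : Subgroup Γ) [N.Normal] : CoricPair Γ :=
  P.restrict (P.fixedSub N)

/-- The `Γ`-action on the sub-pair of `N`-invariants factors through `Γ ↠ Γ/N` (tautology).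
([IUTchI] Ex 5.1 (v) p.129) [claim: Mochizuki2012, status: disputed] -/
theorem invariants_factorsThrough (P : CoricPair Γ) (N : Subgroup Γ) [N.Normal] :
    (P.invariants N).FactorsThrough N := by
  intro n hn x
  exact Subtype.ext (x.2 n hn)

/-- An isomorphism of pairs carries `N`-fixed elements to `N`-fixed elements (equivariance).
([IUTchI] Ex 5.1 (v) p.129) [claim: Mochizuki2012, status: disputed] -/
theorem Iso.apply_mem_fixedSub_iff {P Q : CoricPair Γ} (e : Iso P Q) (N : Subgroup Γ) [N.Normal]
    (x : P.carrier) : e.toEquiv x ∈ Q.fixedSub N ↔ x ∈ P.fixedSub N := by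
  rw [CoricPair.mem_fixedSub_iff, CoricPair.mem_fixedSub_iff]
  constructor
  · intro h n hn
    apply e.toEquiv.injective
    rw [e.smul, h n hn]
  · intro h n hn
    rw [← e.smul, h n hn]

/-- An isomorphism of pairs RESTRICTS to an isomorphism of the sub-pairs of `N`-invariants
(functoriality of "`(−)^N`" in isomorphisms of pairs). ([IUTchI] Ex 5.1 (v) p.129)
[claim: Mochizuki2012, status: disputed] -/
def Iso.invariants {P Q : CoricPair Γ} (e : Iso P Q) (N : Subgroup Γ) [N.Normal] :
    Iso (P.invariants N) (Q.invariants N) where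
  toEquiv :=
    { toFun := fun x => ⟨e.toEquiv x.1, (e.apply_mem_fixedSub_iff N x.1).mpr x.2⟩
      invFun := fun y => ⟨e.symm.toEquiv y.1, (e.symm.apply_mem_fixedSub_iff N y.1).mpr y.2⟩
      left_inv := fun x => Subtype.ext (e.symm_apply_apply x.1)
      right_inv := fun y => Subtype.ext (e.apply_symm_apply y.1) }
  smul g x := Subtype.ext (e.smul g x.1)
  dom p := by
    constructor
    · rintro ⟨h, hS⟩
      refine ⟨(e.dom (p.1.1, p.2.1)).mp h, ?_⟩
      have hop := e.op ⟨(p.1.1, p.2.1), h⟩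
      have hmem : e.toEquiv (P.pm.op ⟨(p.1.1, p.2.1), h⟩) ∈ Q.fixedSub N :=
        (e.apply_mem_fixedSub_iff N _).mpr hS
      rw [hop] at hmem
      exact hmem
    · rintro ⟨h, hS⟩
      have h' : (p.1.1, p.2.1) ∈ P.pm.dom := (e.dom (p.1.1, p.2.1)).mpr h
      refine ⟨h', ?_⟩
      have hop := e.op ⟨(p.1.1, p.2.1), h'⟩
      have hmem : Q.pm.op ⟨(e.toEquiv p.1.1, e.toEquiv p.2.1), (e.dom (p.1.1, p.2.1)).mp h'⟩ ∈
          Q.fixedSub N := hS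
      rw [← hop] at hmem
      exact (e.apply_mem_fixedSub_iff N _).mp hmem
  op p := Subtype.ext (e.op ⟨(p.1.1.1, p.1.2.1), p.2.1⟩)

end CoricPair

/-- A coric structure relative to a model restricts to a coric structure of the `N`-invariant
sub-pairs: an ∞κ-coric (resp. ∞κ×-coric) structure `†𝕄^⊛_∞κ` (resp. `†𝕄^⊛_∞κ×`) on `†ℱ^⊛` yields
`†𝕄^⊛_κ := (†𝕄^⊛_∞κ)^{π₁^rat}` (resp. `†𝕄^⊛_{κ-sol} := (†𝕄^⊛_∞κ×)^{π₁^{rat/κ-sol}}`) ISOMORPHIC to the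
corresponding sub-pair of the model (p. 128 l. 79 – p. 129 l. 4).  PROVED. ([IUTchI] Ex 5.1 (v) p.129)
[claim: Mochizuki2012, status: disputed] -/
theorem IsCoricStructure.invariants {model P : CoricPair Γ} (h : IsCoricStructure Γ model P)
    (N : Subgroup Γ) [N.Normal] : IsCoricStructure Γ (model.invariants N) (P.invariants N) :=
  ⟨⟨h.nonempty_iso.some.invariants N⟩⟩

end Invariants

namespace NFBridgeRecon

variable (N : NFBridgeRecon.{u})

/-- `𝕄^⊛_{κ-sol}(†𝒟^⊚)` IS the carrier of the `π₁^{rat/κ-sol}(†𝒟^⊛)`-invariant sub-pair of the model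
∞κ×-pair: abc-iut-L5-t1's literal `NFBridgeRecon.MκSol` (p. 124) and the sub-pair agree
(definitionally, up to the subtype packaging). ([IUTchI] Ex 5.1 (v) p.129)
[claim: Mochizuki2012, status: disputed] -/
theorem mem_infκxPair_fixedSub_ratKsolKer_iff (x : N.infκxPair.carrier) :
    x ∈ N.infκxPair.fixedSub N.ratKsolKer ↔ (x : N.Krat) ∈ N.MκSol := by
  rw [CoricPair.mem_fixedSub_iff]
  constructor
  · intro h
    exact ⟨x.2, fun g hg => congrArg (fun y : N.infκxPair.carrier => (y : N.Krat)) (h g hg)⟩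
  · rintro ⟨-, h⟩ g hg
    exact Subtype.ext (h g hg)

/-- Under the printed identification `𝕄^⊛_κ = (𝕄^⊛_∞κ)^{π₁^rat}` (abc-iut-L5-t1's `MκIsInvariants`,
p. 124), `𝕄^⊛_κ(†𝒟^⊚)` IS the carrier of the `π₁^rat(†𝒟^⊛)`-invariant sub-pair (`N = ⊤`) of the model
∞κ-pair. ([IUTchI] Ex 5.1 (v) p.129) [claim: Mochizuki2012, status: disputed] -/
theorem mem_infκPair_fixedSub_top_iff (hκ : N.MκIsInvariants) (x : N.infκPair.carrier) :
    x ∈ N.infκPair.fixedSub ⊤ ↔ (x : N.Krat) ∈ N.Mκ := by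
  rw [CoricPair.mem_fixedSub_iff, hκ.eq]
  constructor
  · intro h
    exact ⟨x.2, fun g => congrArg (fun y : N.infκPair.carrier => (y : N.Krat)) (h g trivial)⟩
  · rintro ⟨-, h⟩ g -
    exact Subtype.ext (h g)

/-- **Ex. 5.1 (v), p. 129** for an ∞κ×-coric structure `P`: its `π₁^{rat/κ-sol}`-invariants
`†𝕄^⊛_{κ-sol}` form a pair ISOMORPHIC to the model's `𝕄^⊛_{κ-sol}(†𝒟^⊚)`-pair, on which the action
factors through `π₁^{κ-sol}(†𝒟^⊛)`.  PROVED. ([IUTchI] Ex 5.1 (v) p.129) [claim: Mochizuki2012, status: disputed] -/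
theorem IsCoricStructure.kappaSol_invariants {P : CoricPair N.piRat}
    (h : IsCoricStructure N.piRat N.infκxPair P) :
    IsCoricStructure N.piRat (N.infκxPair.invariants N.ratKsolKer) (P.invariants N.ratKsolKer) ∧
      (P.invariants N.ratKsolKer).FactorsThrough N.ratKsolKer :=
  ⟨h.invariants N.ratKsolKer, P.invariants_factorsThrough N.ratKsolKer⟩

end NFBridgeRecon

end Literature.IUT.HodgeTheaters
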